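import Summits.ResolutionOfSingularities.ResolutionOfSingularities.Theorems.FrobeniusClosingSteerSigmaTopLegalityOddDivisor
import Summits.ResolutionOfSingularities.ResolutionOfSingularities.Theorems.FrobeniusClosingSteerGeoDictShorts
import Literature.AlgebraicGeometry.Resolution.RegularLocalRingsNormal
import Literature.AlgebraicGeometry.Resolution.RsopLocalization
import HarnessLib

/-!
# Crux `Steer` (stmt-ResolutionOfSingularities-16345), chain W4.1: KERNEL BRICKS for the ODD BRANCH (Par-O) of the
# F-B tail — (P2-loc) generic ⇒ local oddness, (P2) `isPermissibleCentre_of_two_odd`, (P3) the exceptional-parameter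
# dichotomy of a point step (Theses-free, def-free research support)

OURS (campaign `res-hironaka`, rung L ★L-G4, slot W4.1; statements about the route's own objects; they replace the
role of no printed item and are NOT statements of the manuscript under review [claim: Hironaka2017, status:
under-review]; AI review is weaker than expert review). Seat res-D-pv-003 (gen 6) on res-L0-w41-plan-1 RULING 108c /
109 (3) («(Par-O)(ii) bricks»); author of the argument: res-L0-w41-tri-1 g5, PREREG-FB v1.6 / v1.6.1 D·S6 «branch (O)
of the F-B tail is EMPTY by legality + valuation rank», steps (P2)–(P3), with res-L0-w41-tri-3 g5's row R-Q supply line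
(HOME/STATUS 2026-08-27T11:16:59Z). The (P4)/(P5) squeeze is `…OddBranchVFree.lean` (tri-1, filed by res-type-062) and
the (Par-P) assembly is res-type-062's `…OddBranchPersistence.lean`; nothing of either is restated here.

## §1 (P2-loc) «generic oddness ⇒ local square residue» (tri-3 R-Q supply line; any exponent `n`, any characteristic)

For a REGULAR local ring `S` and a regular parameter `x ∈ 𝔪 ∖ 𝔪²` the quotient `S ⧸ (x)` is regular (Matsumura 14.2),
hence a NORMAL domain (Matsumura 19.4). So if `f` is an `n`-th power GENERICALLY along `V(x)` — `s ^ n * f − a ^ n ∈ (x)`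
for some `s ∉ (x)` (an `n`-th power in the residue field `κ(V(x)) = Frac (S ⧸ (x))` of the divisor) — then `f` is an
`n`-th power modulo `(x)` in `S` itself: `∃ g, f − g ^ n ∈ (x)` (`exists_sub_pow_mem_span_singleton_of_generic`;
Mathlib `IsIntegrallyClosed.pow_dvd_pow_iff`). This turns the run's GENERIC parity of a tail-born divisor
(«`r̄_E = 1`», read in the DVR of `E`) into the LOCAL hypothesis `f − g_b² ∈ (x_b)` of (P2).

## §2 (P2) `isPermissibleCentre_of_two_odd` (tri-1 D·S6 (P2) = D·S2 + N4; assembly over res-D-pv-004's bricks)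

On a regular local member `R ⊆ K` (`K` of characteristic `2`) of dimension `c ≥ 3`, let `x_a, x_b` be PART OF A
REGULAR SYSTEM OF PARAMETERS (`IsRsopPart ![x_a, x_b]`: two boundary components crossing normally at the centre) modulo
each of which the radicand `f` of `T² = f` is a square (two ODD components), and suppose the torsor has no singular prime
of height `0` or `1` (generic fibre regular, no singular divisor — the post-strip situation, N4; hypotheses `h0`, `h1`
exactly as in res-D-pv-004's `isTopSingComponent_of_height_two`, NOT discharged here). Then `Q = (x_a, x_b)` is a
σ_top-PERMISSIBLE CENTRE (`SigmaTopLegality.IsPermissibleCentre R 2 f Q`): `Q` is prime with `R ⧸ Q` regular and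
`ht Q = 2` (`IsRsopPart` API), it is a singular prime by res-D-pv-004 / tri-1's (L5) `isSingPrime_span_pair_of_sq_mod_both`,
a top singular component by (Fb) `isTopSingComponent_of_height_two`, `≠ 𝔪` since `c ≥ 3`, and the equimultiplicity
clause is automatic at `p = 2` ((L1c)/(Fc)). Hence σ_top does NOT take the point step there
(`exists_isPermissibleCentre_of_two_odd`, `not_forall_not_isPermissibleCentre_of_two_odd`); with §1 the oddness
hypotheses may be given generically (`isPermissibleCentre_of_two_generic_odd`).

## §3 (P3) the EXCEPTIONAL-PARAMETER DICHOTOMY of a local blowing up (tri-1 D·S6 (P3); def-free over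
`IsLocalBlowupAlong`, the three fields of the word `IsExcParamAlong` taken as separate hypotheses as in
`GeoDict.exists_mem_mul_of_isExcParamAlong`)

Let `R₁` be the local blowing up of `R` along `P` with respect to `O`, `u` an exceptional parameter (an element of `P`
of maximal `O`-value) and `x ∈ P`, `x ≠ 0`. Then `x / u ∈ R₁` (`div_mem_of_excParam`), and EITHER `v(x) < v(u)` —
equivalently `x / u` lies in the maximal ideal of `R₁` (`mem_maximalIdeal_target_iff`: the target is dominated by
`O`), i.e. the centre of `O` on `R₁` lies on the STRICT TRANSFORM `V(x/u)` of `V(x)` as well as on the new exceptional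
divisor `V(u)` (`two_divisors_of_valuation_lt`: `x = u · (x/u)` with both factors in `𝔪_{R₁}`) — OR `v(x) = v(u)` and
then `x` is itself an exceptional parameter (`excParam_of_valuation_le`), `u / x` is a unit of `R₁` and `P · R₁ = x · R₁`
(`excParam_dichotomy`, `forall_div_mem_of_valuation_le`): the exceptional parameter `x` PERSISTS. Iterating the second
alternative along the point steps of a tail is res-type-062's `weakPersistence_of_pointSteps`; excluding the first
alternative at every late point step is (P1) + §2 (two odd divisors through the next centre ⇒ a permissible centre ⇒
no point step) — the words for «odd» along the run are res-L0-w41-strat-2's §σ2.28, not typed here.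

No Theses file is imported; nothing here is a route item or a registration. [cite: Matsumura1987, Thm. 14.2]
[cite: Matsumura1987, Thm. 19.4] [cite: NovacoskiSpivakovsky2014, Def. 2.11]
-/

noncomputable section

-- `Summit.<S>.<S>.…` duplicates the summit name by design (single-problem summit).
set_option linter.dupNamespace false

open IsLocalRing

namespace Summit.ResolutionOfSingularities.ResolutionOfSingularities.Theorems.SwitchingDichotomy.OddBranchParity

open Literature.AlgebraicGeometry.Resolution
open SigmaTopLegality

/-! ## §1 (P2-loc) Generic `n`-th power along a regular parameter divisor ⇒ `n`-th power modulo the parameter -/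

section GenericToLocal

variable {S : Type*} [CommRing S]

/-- In a NORMAL DOMAIN: if `s ^ n * f = a ^ n` with `s ≠ 0` (`f` is an `n`-th power in the fraction field) then `f`
is an `n`-th power (`n ≠ 0`). Mathlib's `IsIntegrallyClosed.pow_dvd_pow_iff`. [folklore] -/
theorem exists_eq_pow_of_pow_mul_eq_pow [IsDomain S] [IsIntegrallyClosed S] {n : ℕ} (hn : n ≠ 0) {f a s : S}
    (hs : s ≠ 0) (h : s ^ n * f = a ^ n) : ∃ g : S, f = g ^ n := by
  have hdvd : s ^ n ∣ a ^ n := ⟨f, h.symm⟩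
  obtain ⟨g, rfl⟩ := (IsIntegrallyClosed.pow_dvd_pow_iff hn).mp hdvd
  refine ⟨g, ?_⟩
  have hsn : s ^ n ≠ 0 := pow_ne_zero n hs
  rw [mul_pow] at h
  exact mul_left_cancel₀ hsn h

/-- **(P2-loc) generic ⇒ local** (res-L0-w41-tri-3 row R-Q supply line). For a regular local ring `S`, a regular
parameter `x ∈ 𝔪 ∖ 𝔪²` and `n ≠ 0`: if `s ^ n * f − a ^ n ∈ (x)` for some `s ∉ (x)` («`f` is an `n`-th power in the
residue field of the divisor `V(x)`», e.g. an ODD fully-stripped exceptional divisor at `n = p = 2`), then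
`f − g ^ n ∈ (x)` for some `g ∈ S`. Proof: `S ⧸ (x)` is a regular local ring (Matsumura 14.2), hence an integrally
closed domain (Matsumura 19.4), and `exists_eq_pow_of_pow_mul_eq_pow` applies to the residues.
[cite: Matsumura1987, Thm. 14.2] [cite: Matsumura1987, Thm. 19.4] -/
theorem exists_sub_pow_mem_span_singleton_of_generic [IsRegularLocalRing S] {x : S} (hx : x ∈ maximalIdeal S)
    (hx2 : x ∉ maximalIdeal S ^ 2) {n : ℕ} (hn : n ≠ 0) {f a s : S} (hs : s ∉ Ideal.span ({x} : Set S))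
    (h : s ^ n * f - a ^ n ∈ Ideal.span ({x} : Set S)) : ∃ g : S, f - g ^ n ∈ Ideal.span ({x} : Set S) := by
  haveI := (IsRegularLocalRing.quotient_span_singleton hx hx2).1
  haveI : IsDomain (S ⧸ Ideal.span ({x} : Set S)) := isDomain_of_isRegularLocalRing _
  haveI : IsIntegrallyClosed (S ⧸ Ideal.span ({x} : Set S)) := isIntegrallyClosed_of_isRegularLocalRing _
  have hs' : Ideal.Quotient.mk (Ideal.span ({x} : Set S)) s ≠ 0 := by
    rwa [Ne, Ideal.Quotient.eq_zero_iff_mem]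
  have h' : Ideal.Quotient.mk (Ideal.span ({x} : Set S)) s ^ n * Ideal.Quotient.mk (Ideal.span ({x} : Set S)) f =
      Ideal.Quotient.mk (Ideal.span ({x} : Set S)) a ^ n := by
    rw [← map_pow, ← map_mul, ← map_pow, eq_comm, ← sub_eq_zero, ← map_sub, Ideal.Quotient.eq_zero_iff_mem]
    have : a ^ n - s ^ n * f = -(s ^ n * f - a ^ n) := by ring
    rw [this]
    exact neg_mem_iff.mpr h
  obtain ⟨gbar, hg⟩ := exists_eq_pow_of_pow_mul_eq_pow hn hs' h'
  obtain ⟨g, rfl⟩ := Ideal.Quotient.mk_surjective gbar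
  refine ⟨g, ?_⟩
  rw [← Ideal.Quotient.eq_zero_iff_mem, map_sub, map_pow, hg, sub_self]

/-- The same with the generic hypothesis packaged as an existential. [cite: Matsumura1987, Thm. 19.4] -/
theorem exists_sub_pow_mem_span_singleton_of_generic' [IsRegularLocalRing S] {x : S} (hx : x ∈ maximalIdeal S)
    (hx2 : x ∉ maximalIdeal S ^ 2) {n : ℕ} (hn : n ≠ 0) {f : S}
    (h : ∃ a s : S, s ∉ Ideal.span ({x} : Set S) ∧ s ^ n * f - a ^ n ∈ Ideal.span ({x} : Set S)) :
    ∃ g : S, f - g ^ n ∈ Ideal.span ({x} : Set S) := by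
  obtain ⟨a, s, hs, h⟩ := h
  exact exists_sub_pow_mem_span_singleton_of_generic hx hx2 hn hs h

/-- Conversely (trivially) a local `n`-th power residue is a generic one (`s = 1`). [folklore] -/
theorem generic_of_sub_pow_mem_span_singleton [IsLocalRing S] {x : S} (hx : x ∈ maximalIdeal S) {n : ℕ} {f g : S}
    (h : f - g ^ n ∈ Ideal.span ({x} : Set S)) :
    ∃ a s : S, s ∉ Ideal.span ({x} : Set S) ∧ s ^ n * f - a ^ n ∈ Ideal.span ({x} : Set S) := by
  refine ⟨g, 1, fun h1 => ?_, by simpa using h⟩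
  have hle : Ideal.span ({x} : Set S) ≤ maximalIdeal S := (Ideal.span_singleton_le_iff_mem _).mpr hx
  exact (IsLocalRing.maximalIdeal.isMaximal S).ne_top (Ideal.eq_top_of_isUnit_mem _ (hle h1) isUnit_one)

end GenericToLocal

/-! ## §2 (P2) Two odd normally-crossing divisors through the centre ⇒ a σ_top-permissible centre -/

section TwoOdd

variable {K : Type} [Field K]

/-- For a pair `x_a, x_b` forming part of a regular system of parameters of the local member `R`: the ideal
`(x_a, x_b)` is prime, `R ⧸ (x_a, x_b)` is a regular local ring, `ht (x_a, x_b) = 2`, and `dim R ⧸ (x_a, x_b) + 2 = dim R`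
(the `IsRsopPart` API of the tree, re-keyed to `Ideal.span {x_a, x_b}`). [cite: Matsumura1987, Thm. 14.2] -/
theorem span_pair_of_isRsopPart (R : Subring K) [IsLocalRing R] {xa xb : R} (hc : IsRsopPart ![xa, xb]) :
    (Ideal.span ({xa, xb} : Set R)).IsPrime ∧ IsRegularLocalRing (R ⧸ Ideal.span ({xa, xb} : Set R)) ∧
      (Ideal.span ({xa, xb} : Set R)).height = 2 ∧
      ringKrullDim (R ⧸ Ideal.span ({xa, xb} : Set R)) + 2 = ringKrullDim R := by
  have hr : Ideal.span (Set.range ![xa, xb]) = Ideal.span ({xa, xb} : Set R) := by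
    rw [Matrix.range_cons_cons_empty]
  refine ⟨?_, ?_, ?_, ?_⟩
  · rw [← hr]; exact hc.isPrime_span_range
  · rw [← hr]; exact hc.isRegularLocalRing_quotient
  · rw [← hr, hc.height_span_range]; rfl
  · rw [← hr]; exact_mod_cast hc.ringKrullDim_quotient_add

/-- In dimension `c ≥ 3` the pair ideal `(x_a, x_b)` of a part of a regular system of parameters is NOT the maximal
ideal (its height is `2 < c = ht 𝔪`). [folklore] -/
theorem span_pair_ne_maximalIdeal_of_isRsopPart (R : Subring K) [IsLocalRing R] {xa xb : R}
    (hc : IsRsopPart ![xa, xb]) {c : ℕ} (hc3 : 3 ≤ c) (hdim : ringKrullDim R = c) :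
    Ideal.span ({xa, xb} : Set R) ≠ maximalIdeal R := by
  haveI := hc.isRegularLocalRing
  intro heq
  obtain ⟨-, -, h2, -⟩ := span_pair_of_isRsopPart R hc
  rw [heq] at h2
  have hm : ((maximalIdeal R).height : WithBot ℕ∞) = ((c : ℕ∞) : WithBot ℕ∞) := by
    rw [IsLocalRing.maximalIdeal_height_eq_ringKrullDim, hdim]; rfl
  have hm' : (maximalIdeal R).height = (c : ℕ∞) := WithBot.coe_injective hm
  rw [hm'] at h2
  have : c = 2 := by exact_mod_cast h2
  omega

variable [CharP K 2]

/-- **(P2) `isPermissibleCentre_of_two_odd`** (res-L0-w41-tri-1 PREREG-FB v1.6 D·S6 step 2; typed piece (P2)). On a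
regular local member `R ⊆ K` of characteristic `2` and dimension `c ≥ 3`, let `x_a, x_b` be part of a regular system
of parameters, modulo EACH of which the radicand `f` is a square (`f − g_a² ∈ (x_a)`, `f − g_b² ∈ (x_b)`: two ODD
boundary components through the centre), and suppose `T² = f` has no singular prime of height `0` or `1` (the
post-strip situation N4; hypotheses `h0`, `h1`, NOT discharged here). Then `(x_a, x_b)` is a σ_top-PERMISSIBLE CENTRE.
Assembly: (L5) `isSingPrime_span_pair_of_sq_mod_both` + (Fb/Fc) `isPermissibleCentre_two_iff_of_height_two`
(res-D-pv-004) + the `IsRsopPart` API. [cite: Matsumura1987, Thm. 14.2] -/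
theorem isPermissibleCentre_of_two_odd (R : Subring K) [IsRegularLocalRing R] (f xa xb ga gb : R)
    (hc : IsRsopPart ![xa, xb])
    (ha : f - ga ^ 2 ∈ Ideal.span ({xa} : Set R)) (hb : f - gb ^ 2 ∈ Ideal.span ({xb} : Set R))
    (h0 : ∀ (P : Ideal R) [P.IsPrime], P.height = 0 → ¬ IsSingPrime R 2 f P)
    (h1 : ∀ (P : Ideal R) [P.IsPrime], P.height = 1 → ¬ IsSingPrime R 2 f P)
    {c : ℕ} (hc3 : 3 ≤ c) (hdim : ringKrullDim R = c) :
    IsPermissibleCentre R 2 f (Ideal.span ({xa, xb} : Set R)) := by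
  obtain ⟨hprime, hreg, h2, -⟩ := span_pair_of_isRsopPart R hc
  haveI := hprime
  have hpa : Prime xa := by simpa using hc.prime 0
  have hndvd : ¬ xa ∣ xb := by simpa using hc.not_dvd (i := 0) (j := 1) (by decide)
  have hsing : IsSingPrime R 2 f (Ideal.span ({xa, xb} : Set R)) :=
    isSingPrime_span_pair_of_sq_mod_both R f xa xb ga gb hpa hndvd hprime.isRadical ha hb
  have hne := span_pair_ne_maximalIdeal_of_isRsopPart R hc hc3 hdim
  exact (isPermissibleCentre_two_iff_of_height_two R f h0 h1 _ hsing h2 hne).mpr hreg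

/-- **(P2) ⇒ σ_top does not take the point step**: under the hypotheses of `isPermissibleCentre_of_two_odd` a
permissible positive-dimensional centre EXISTS. [cite: Matsumura1987, Thm. 14.2] -/
theorem exists_isPermissibleCentre_of_two_odd (R : Subring K) [IsRegularLocalRing R] (f xa xb ga gb : R)
    (hc : IsRsopPart ![xa, xb])
    (ha : f - ga ^ 2 ∈ Ideal.span ({xa} : Set R)) (hb : f - gb ^ 2 ∈ Ideal.span ({xb} : Set R))
    (h0 : ∀ (P : Ideal R) [P.IsPrime], P.height = 0 → ¬ IsSingPrime R 2 f P)
    (h1 : ∀ (P : Ideal R) [P.IsPrime], P.height = 1 → ¬ IsSingPrime R 2 f P)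
    {c : ℕ} (hc3 : 3 ≤ c) (hdim : ringKrullDim R = c) :
    ∃ Q : Ideal R, IsPermissibleCentre R 2 f Q :=
  ⟨_, isPermissibleCentre_of_two_odd R f xa xb ga gb hc ha hb h0 h1 hc3 hdim⟩

/-- **(P2), the form the σ_top POINT-STEP clause contradicts**: under the hypotheses of `isPermissibleCentre_of_two_odd`
it is FALSE that no ideal is a permissible centre (the clause `∀ Q, ¬ IsPermissibleCentre R 2 f Q` of a point step in
`IsSigmaTopCentre … (maximalIdeal R)`). [cite: Matsumura1987, Thm. 14.2] -/
theorem not_forall_not_isPermissibleCentre_of_two_odd (R : Subring K) [IsRegularLocalRing R] (f xa xb ga gb : R)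
    (hc : IsRsopPart ![xa, xb])
    (ha : f - ga ^ 2 ∈ Ideal.span ({xa} : Set R)) (hb : f - gb ^ 2 ∈ Ideal.span ({xb} : Set R))
    (h0 : ∀ (P : Ideal R) [P.IsPrime], P.height = 0 → ¬ IsSingPrime R 2 f P)
    (h1 : ∀ (P : Ideal R) [P.IsPrime], P.height = 1 → ¬ IsSingPrime R 2 f P)
    {c : ℕ} (hc3 : 3 ≤ c) (hdim : ringKrullDim R = c) :
    ¬ ∀ Q : Ideal R, ¬ IsPermissibleCentre R 2 f Q := fun h =>
  h _ (isPermissibleCentre_of_two_odd R f xa xb ga gb hc ha hb h0 h1 hc3 hdim)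

/-- **(P2) with GENERIC oddness** (§1 + `isPermissibleCentre_of_two_odd`): the two boundary components need only be
odd at their generic points (`s² f − a² ∈ (x)` with `s ∉ (x)`), which is how the run records the parity of a
tail-born divisor. [cite: Matsumura1987, Thm. 19.4] -/
theorem isPermissibleCentre_of_two_generic_odd (R : Subring K) [IsRegularLocalRing R] (f xa xb : R)
    (hc : IsRsopPart ![xa, xb])
    (ha : ∃ a s : R, s ∉ Ideal.span ({xa} : Set R) ∧ s ^ 2 * f - a ^ 2 ∈ Ideal.span ({xa} : Set R))
    (hb : ∃ a s : R, s ∉ Ideal.span ({xb} : Set R) ∧ s ^ 2 * f - a ^ 2 ∈ Ideal.span ({xb} : Set R))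
    (h0 : ∀ (P : Ideal R) [P.IsPrime], P.height = 0 → ¬ IsSingPrime R 2 f P)
    (h1 : ∀ (P : Ideal R) [P.IsPrime], P.height = 1 → ¬ IsSingPrime R 2 f P)
    {c : ℕ} (hc3 : 3 ≤ c) (hdim : ringKrullDim R = c) :
    IsPermissibleCentre R 2 f (Ideal.span ({xa, xb} : Set R)) := by
  haveI := hc.isRegularLocalRing
  have hxa : xa ∈ maximalIdeal R := by simpa using hc.mem_maximalIdeal 0
  have hxb : xb ∈ maximalIdeal R := by simpa using hc.mem_maximalIdeal 1
  have hxa2 : xa ∉ maximalIdeal R ^ 2 := by simpa using hc.not_mem_sq 0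
  have hxb2 : xb ∉ maximalIdeal R ^ 2 := by simpa using hc.not_mem_sq 1
  obtain ⟨ga, hga⟩ := exists_sub_pow_mem_span_singleton_of_generic' hxa hxa2 two_ne_zero ha
  obtain ⟨gb, hgb⟩ := exists_sub_pow_mem_span_singleton_of_generic' hxb hxb2 two_ne_zero hb
  exact isPermissibleCentre_of_two_odd R f xa xb ga gb hc hga hgb h0 h1 hc3 hdim

end TwoOdd

/-! ## §3 (P3) The exceptional-parameter dichotomy of a local blowing up (def-free over `IsLocalBlowupAlong`) -/

section ExcParam

variable {K : Type} [Field K] {O : ValuationSubring K} {R R₁ : Subring K} {P : Ideal R}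

/-- The TARGET of a local blowing up is dominated by `O`: for `z ∈ R₁`, `z ∈ 𝔪_{R₁} ↔ v(z) < 1`.
[cite: NovacoskiSpivakovsky2014, Def. 2.11] -/
theorem mem_maximalIdeal_target_iff (hbl : IsLocalBlowupAlong O R P R₁) [IsLocalRing R₁] (z : R₁) :
    z ∈ maximalIdeal R₁ ↔ O.valuation (z : K) < 1 := by
  have hR₁O : R₁ ≤ O.toSubring := hbl.isLocalBlowup.target_le
  have hdom : SubringDominates (locAtCentre R₁ O) O.toSubring := subringDominates_locAtCentre hR₁O
  rw [hbl.isLocalBlowup.locAtCentre_eq] at hdom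
  exact (subringDominates_valuationSubring_iff hR₁O).mp hdom z

/-- **`x / u ∈ R₁`** for `x ∈ P` and an exceptional parameter `u` of the local blowing up of `R` along `P`
(`GeoDict.exists_mem_mul_of_isExcParamAlong` in quotient form). [cite: NovacoskiSpivakovsky2014, Def. 2.11] -/
theorem div_mem_of_excParam (hbl : IsLocalBlowupAlong O R P R₁) {u : K} (huP : ∃ hu : u ∈ R, (⟨u, hu⟩ : R) ∈ P)
    (hu0 : u ≠ 0) (humax : ∀ y : R, y ∈ P → O.valuation (y : K) ≤ O.valuation u)
    {x : K} (hxP : ∃ hx : x ∈ R, (⟨x, hx⟩ : R) ∈ P) : x / u ∈ R₁ := by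
  obtain ⟨hx, hxP⟩ := hxP
  obtain ⟨r, hr, hxr⟩ := GeoDict.exists_mem_mul_of_isExcParamAlong hbl huP hu0 humax ⟨x, hx⟩ hxP
  have : x / u = r := by
    rw [show (x : K) = r * u from hxr, mul_div_assoc, div_self hu0, mul_one]
  rw [this]
  exact hr

/-- The value of `x ∈ P` is AT MOST that of an exceptional parameter; hence `v(x / u) ≤ 1`. [folklore] -/
theorem valuation_div_excParam_le_one {u : K}
    (humax : ∀ y : R, y ∈ P → O.valuation (y : K) ≤ O.valuation u)
    {x : K} (hxP : ∃ hx : x ∈ R, (⟨x, hx⟩ : R) ∈ P) : O.valuation (x / u) ≤ 1 := by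
  obtain ⟨hx, hxP⟩ := hxP
  have h := humax ⟨x, hx⟩ hxP
  rw [map_div₀]
  exact div_le_one_of_le₀ h zero_le

/-- **An element of `P` of value `≥ v(u)` is itself an exceptional parameter** (the three fields of `IsExcParamAlong`
for `x`). [folklore] -/
theorem excParam_of_valuation_le {u : K} (hu0 : u ≠ 0)
    (humax : ∀ y : R, y ∈ P → O.valuation (y : K) ≤ O.valuation u)
    {x : K} (hxP : ∃ hx : x ∈ R, (⟨x, hx⟩ : R) ∈ P) (hle : O.valuation u ≤ O.valuation x) :
    (∃ hx : x ∈ R, (⟨x, hx⟩ : R) ∈ P) ∧ x ≠ 0 ∧ ∀ y : R, y ∈ P → O.valuation (y : K) ≤ O.valuation x := by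
  refine ⟨hxP, fun hx0 => ?_, fun y hy => (humax y hy).trans hle⟩
  rw [hx0, map_zero, nonpos_iff_eq_zero] at hle
  exact ((Valuation.ne_zero_iff _).mpr hu0) hle

/-- Two exceptional parameters have the SAME value. [folklore] -/
theorem valuation_eq_of_excParam {u x : K} (huP : ∃ hu : u ∈ R, (⟨u, hu⟩ : R) ∈ P)
    (humax : ∀ y : R, y ∈ P → O.valuation (y : K) ≤ O.valuation u)
    (hxP : ∃ hx : x ∈ R, (⟨x, hx⟩ : R) ∈ P) (hxmax : ∀ y : R, y ∈ P → O.valuation (y : K) ≤ O.valuation x) :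
    O.valuation x = O.valuation u := by
  obtain ⟨hu, huP⟩ := huP
  obtain ⟨hx, hxP⟩ := hxP
  exact le_antisymm (humax ⟨x, hx⟩ hxP) (hxmax ⟨u, hu⟩ huP)

/-- **(P3) THE DICHOTOMY** (res-L0-w41-tri-1 PREREG-FB v1.6 D·S6 step 3). For the local blowing up `R₁` of `R` along
`P` (w.r.t. `O`), an exceptional parameter `u` and `x ∈ P`: EITHER `v(x) < v(u)` (the centre of `O` on `R₁`
lies on the strict transform `V(x/u)` of `V(x)`), OR `x` is itself an exceptional parameter (`v(x) = v(u)`; then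
`P · R₁ = x · R₁`, see `forall_div_mem_of_valuation_le`). [cite: NovacoskiSpivakovsky2014, Def. 2.11] -/
theorem excParam_dichotomy {u : K} (hu0 : u ≠ 0)
    (humax : ∀ y : R, y ∈ P → O.valuation (y : K) ≤ O.valuation u)
    {x : K} (hxP : ∃ hx : x ∈ R, (⟨x, hx⟩ : R) ∈ P) :
    O.valuation x < O.valuation u ∨
      ((∃ hx : x ∈ R, (⟨x, hx⟩ : R) ∈ P) ∧ x ≠ 0 ∧ ∀ y : R, y ∈ P → O.valuation (y : K) ≤ O.valuation x) := by
  rcases lt_or_ge (O.valuation x) (O.valuation u) with hlt | hle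
  · exact Or.inl hlt
  · exact Or.inr (excParam_of_valuation_le hu0 humax hxP hle)

/-- **First alternative read on `R₁`**: `v(x) < v(u)` iff `x / u` lies in the MAXIMAL IDEAL of the target (the centre
of `O` on `R₁` lies on the strict transform of `V(x)`). [cite: NovacoskiSpivakovsky2014, Def. 2.11] -/
theorem div_mem_maximalIdeal_iff (hbl : IsLocalBlowupAlong O R P R₁) [IsLocalRing R₁] {u : K}
    (huP : ∃ hu : u ∈ R, (⟨u, hu⟩ : R) ∈ P) (hu0 : u ≠ 0)
    (humax : ∀ y : R, y ∈ P → O.valuation (y : K) ≤ O.valuation u)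
    {x : K} (hxP : ∃ hx : x ∈ R, (⟨x, hx⟩ : R) ∈ P) :
    (⟨x / u, div_mem_of_excParam hbl huP hu0 humax hxP⟩ : R₁) ∈ maximalIdeal R₁ ↔
      O.valuation x < O.valuation u := by
  rw [mem_maximalIdeal_target_iff hbl]
  change O.valuation (x / u) < 1 ↔ _
  have hv0 : 0 < O.valuation u := pos_iff_ne_zero.mpr ((Valuation.ne_zero_iff _).mpr hu0)
  rw [map_div₀, div_lt_one₀ hv0]

/-- **Second alternative: PERSISTENCE** — if `v(u) ≤ v(x)` for `x ∈ P` then every element of `P` is an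
`R₁`-multiple of `x` (`P · R₁ = x · R₁`: `a / x ∈ R₁` for `a ∈ P`). [cite: NovacoskiSpivakovsky2014, Def. 2.11] -/
theorem forall_div_mem_of_valuation_le (hbl : IsLocalBlowupAlong O R P R₁) {u : K} (hu0 : u ≠ 0)
    (humax : ∀ y : R, y ∈ P → O.valuation (y : K) ≤ O.valuation u)
    {x : K} (hxP : ∃ hx : x ∈ R, (⟨x, hx⟩ : R) ∈ P) (hle : O.valuation u ≤ O.valuation x) :
    ∀ a : R, a ∈ P → (a : K) / x ∈ R₁ := by
  obtain ⟨hxP', hx0, hxmax⟩ := excParam_of_valuation_le hu0 humax hxP hle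
  intro a ha
  exact div_mem_of_excParam hbl hxP' hx0 hxmax ⟨a.2, by simpa using ha⟩

/-- **Second alternative: `u / x` is a UNIT of `R₁`** (both `u / x` and `x / u` lie in `R₁`). [folklore] -/
theorem div_mem_and_inv_mem_of_valuation_le (hbl : IsLocalBlowupAlong O R P R₁) {u : K}
    (huP : ∃ hu : u ∈ R, (⟨u, hu⟩ : R) ∈ P) (hu0 : u ≠ 0)
    (humax : ∀ y : R, y ∈ P → O.valuation (y : K) ≤ O.valuation u)
    {x : K} (hxP : ∃ hx : x ∈ R, (⟨x, hx⟩ : R) ∈ P) (hle : O.valuation u ≤ O.valuation x) :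
    u / x ∈ R₁ ∧ x / u ∈ R₁ := by
  obtain ⟨hu, huP'⟩ := huP
  exact ⟨forall_div_mem_of_valuation_le hbl hu0 humax hxP hle ⟨u, hu⟩ huP',
    div_mem_of_excParam hbl ⟨hu, huP'⟩ hu0 humax hxP⟩

/-- **First alternative: TWO DIVISORS THROUGH THE NEW CENTRE** (the geometric reading used by (P2)). If `v(x) < v(u)`
for `x ∈ P` and `v(u) < 1` (e.g. `P ⊆ 𝔪_R` with `R` dominated by `O`), then in the local target `R₁` both `u` (the
new exceptional divisor `V(u) ⊇ P · R₁ = u · R₁`) and `x / u` (the strict transform of `V(x)`) lie in the maximal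
ideal, and `x = u · (x / u)`. [cite: NovacoskiSpivakovsky2014, Def. 2.11] -/
theorem two_divisors_of_valuation_lt (hbl : IsLocalBlowupAlong O R P R₁) [IsLocalRing R₁] {u : K}
    (huP : ∃ hu : u ∈ R, (⟨u, hu⟩ : R) ∈ P) (hu0 : u ≠ 0)
    (humax : ∀ y : R, y ∈ P → O.valuation (y : K) ≤ O.valuation u) (hu1 : O.valuation u < 1)
    {x : K} (hxP : ∃ hx : x ∈ R, (⟨x, hx⟩ : R) ∈ P) (hlt : O.valuation x < O.valuation u) :
    ∃ (hu₁ : u ∈ R₁) (hxu : x / u ∈ R₁),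
      (⟨u, hu₁⟩ : R₁) ∈ maximalIdeal R₁ ∧ (⟨x / u, hxu⟩ : R₁) ∈ maximalIdeal R₁ ∧ x = u * (x / u) := by
  have hu₁ : u ∈ R₁ := hbl.isLocalBlowup.le huP.1
  refine ⟨hu₁, div_mem_of_excParam hbl huP hu0 humax hxP, ?_, ?_, ?_⟩
  · rw [mem_maximalIdeal_target_iff hbl]; exact hu1
  · exact (div_mem_maximalIdeal_iff hbl huP hu0 humax hxP).mpr hlt
  · rw [mul_div_cancel₀ _ hu0]

/-- For a local SOURCE dominated by `O` (`R = R_{𝔪_O ∩ R}`, as every member of a run is) and `P ⊆ 𝔪_R`, an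
exceptional parameter has value `< 1`. [folklore] -/
theorem valuation_lt_one_of_mem (hRO : R ≤ O.toSubring) [IsLocalRing R] (hloc : locAtCentre R O = R)
    {u : K} (huP : ∃ hu : u ∈ R, (⟨u, hu⟩ : R) ∈ P) (hP : P ≤ maximalIdeal R) : O.valuation u < 1 := by
  obtain ⟨hu, huP⟩ := huP
  have hdom : SubringDominates (locAtCentre R O) O.toSubring := subringDominates_locAtCentre hRO
  rw [hloc] at hdom
  exact ((subringDominates_valuationSubring_iff hRO).mp hdom ⟨u, hu⟩).mp (hP huP)

end ExcParam

end Summit.ResolutionOfSingularities.ResolutionOfSingularities.Theorems.SwitchingDichotomy.OddBranchParity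

end
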